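import Mathlib.GroupTheory.SpecificGroups.Quaternion
import Summits.MatrixMultiplication.OmegaCensus.C2QuaternionNoLaw
import Summits.MatrixMultiplication.OmegaCensus.C2DihedralLowerBound
import Summits.MatrixMultiplication.OmegaCensus.DicyclicLawModOne
import Summits.MatrixMultiplication.OmegaCensus.DihedralLikeLawGap
import Summits.MatrixMultiplication.OmegaCensus.DicyclicLawClassification
import HarnessLib

/-!
# The law for `C₂ × Q_{4m}`: `β = 16⌊2m/3⌋ = 2β(Q_{4m})` unless `m ≡ 1 (mod 3)`

ω-census, family (b3).  Framing: lottery ticket; floor = certified bounds/negative ranges.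

`C₂ × Q_{4m} = Multiplicative (ZMod 2) × QuaternionGroup m` is the dihedral-like group `G(ℤ₂ × ℤ_{2m}, (0, m))`, `|A| = 4m`.
* `c2_quaternion_volume_ge`: `β ≥ 2β(Q_{4m}) = 16⌊2m/3⌋` (product of `(C₂, 1, 1)` with the lifted dihedral family,
  `quaternion_volume_ge_law`), `m ≥ 3`.
* `c2_quaternion_law`: **`β(C₂ × Q_{4m}) = 16⌊2m/3⌋` exactly for `m ≥ 5`, `m ≢ 1 (mod 3)`** — `3 ∣ m`: the general law
  `4⌊2|A|/3⌋ = 32m/3`; `m ≡ 2 (mod 3)` (`|A| ≡ 2 (mod 3)`): the dicyclic law `8⌊|A|/3⌋` (`tpp_volume_le_law_dicyclicLike`).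
* `c2_quaternion_law_mod_six_one`: **`m ≡ 1 (mod 6)`, `m ≥ 7`: `β = (32m − 8)/3`**, the mod-one law, ATTAINED (`A = ℤ₂ × ℤ_{2m}`
  with `2m ≡ 2 (mod 4)`: `z2zn_mod_one_law_attained_zero_half`, transported to the Mathlib group by
  `DihedralLikeGroup.equivOfPresentation`).
* `c2_quaternion_window_mod_six_four`: **`m ≡ 4 (mod 6)`: `16⌊2m/3⌋ = (32m−32)/3 ≤ β ≤ (32m−14)/3`** — the law is NOT
  attained (`no_mod_one_law_c2_quaternion`, hypothesis H′) and `law − 1` never occurs (`tpp_volume_mod_one_gap`); the census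
  value at `m = 4` is the bottom, `β(C₂ × Q₁₆) = 32` (LRAT-checked, not kernel).
Compare `β(Q_{4n}) = 8⌊2n/3⌋` (`dicyclic_law_complete`), `β(ℤ_n ⋊ ℤ₄) = 8⌊2n/3⌋` (`semidirect_z4_law_complete`),
`β(C₂ × D_{2k})` (`c2_dihedral_law_even`).
-/

namespace Summit.MatrixMultiplication.OmegaCensus

open Literature.Combinatorics.Additive Finset
open Summit.MatrixMultiplication.MatrixMultiplication.Theorems.JuntaBranch.Planting (tpp_product)

section C2Q

variable {m : ℕ} [NeZero m]

/-- **`β(C₂ × Q_{4m}) ≥ 16⌊2m/3⌋ = 2β(Q_{4m})`** (`m ≥ 3`). [folklore] -/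
theorem c2_quaternion_volume_ge (hm : 3 ≤ m) :
    ∃ S T U : Finset (Multiplicative (ZMod 2) × QuaternionGroup m), TripleProductProperty S T U ∧
      S.card * T.card * U.card = 16 * (2 * m / 3) := by
  obtain ⟨S, T, U, h, hvol⟩ := quaternion_volume_ge_law (n := m) hm
  refine ⟨univ ×ˢ S, {1} ×ˢ T, {1} ×ˢ U, tpp_product tpp_univ_one_one h, ?_⟩
  rw [card_product, card_product, card_product, card_univ, card_singleton, Fintype.card_multiplicative, ZMod.card]
  calc 2 * S.card * (1 * T.card) * (1 * U.card) = 2 * (S.card * T.card * U.card) := by ring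
    _ = 16 * (2 * m / 3) := by rw [hvol]; ring

omit [NeZero m] in
/-- The presentation facts of `C₂ × Q_{4m}` as `G(ℤ₂ × ℤ_{2m}, (0,m))`, packaged: every dihedral-like theorem with the
standard hypothesis list applies. [folklore] -/
theorem c2_quaternion_presentation
    {P : Prop}
    (K : ∀ (ρ τ : ZMod 2 × ZMod (2 * m) → Multiplicative (ZMod 2) × QuaternionGroup m) (c₀ : ZMod 2 × ZMod (2 * m)),
      (∀ a b, ρ a * ρ b = ρ (a + b)) → (∀ a b, ρ a * τ b = τ (b - a)) → (∀ a b, τ a * ρ b = τ (a + b)) →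
      (∀ a b, τ a * τ b = ρ (c₀ + b - a)) → Function.Injective ρ → Function.Injective τ → (∀ a b, ρ a ≠ τ b) →
      (∀ g, (∃ a, ρ a = g) ∨ (∃ a, τ a = g)) → c₀ = ((0 : ZMod 2), (m : ZMod (2 * m))) → P) : P :=
  K (fun p => (Multiplicative.ofAdd p.1, QuaternionGroup.a p.2)) (fun p => (Multiplicative.ofAdd p.1, QuaternionGroup.xa p.2))
    ((0 : ZMod 2), (m : ZMod (2 * m)))
    (fun a b => by
      simp only [Prod.mk_mul_mk, QuaternionGroup.a_mul_a, ← ofAdd_add, Prod.fst_add, Prod.snd_add])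
    (fun a b => by
      simp only [Prod.mk_mul_mk, QuaternionGroup.a_mul_xa, ← ofAdd_add, Prod.fst_sub, Prod.snd_sub]
      rw [sub_eq_add_neg b.1, ZMod.neg_eq_self_mod_two, add_comm b.1])
    (fun a b => by
      simp only [Prod.mk_mul_mk, QuaternionGroup.xa_mul_a, ← ofAdd_add, Prod.fst_add, Prod.snd_add])
    (fun a b => by
      simp only [Prod.mk_mul_mk, QuaternionGroup.xa_mul_xa, ← ofAdd_add, Prod.fst_sub, Prod.snd_sub, Prod.fst_add,
        Prod.snd_add, zero_add]
      rw [sub_eq_add_neg b.1, ZMod.neg_eq_self_mod_two, add_comm b.1])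
    (fun a b hab => by
      simp only [Prod.mk.injEq, QuaternionGroup.a.injEq] at hab
      exact Prod.ext (Multiplicative.ofAdd.injective hab.1) hab.2)
    (fun a b hab => by
      simp only [Prod.mk.injEq, QuaternionGroup.xa.injEq] at hab
      exact Prod.ext (Multiplicative.ofAdd.injective hab.1) hab.2)
    (fun a b hab => by simp at hab)
    (fun g => by
      obtain ⟨i, q⟩ := g
      cases q with
      | a j => exact Or.inl ⟨(Multiplicative.toAdd i, j), rfl⟩
      | xa j => exact Or.inr ⟨(Multiplicative.toAdd i, j), rfl⟩)
    rfl

/-- **The general law in `C₂ × Q_{4m}`**: `|S||T||U| ≤ 4⌊8m/3⌋`. [folklore] -/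
theorem c2_quaternion_tpp_volume_le_law {S T U : Finset (Multiplicative (ZMod 2) × QuaternionGroup m)}
    (h : TripleProductProperty S T U) : S.card * T.card * U.card ≤ 4 * (8 * m / 3) := by
  haveI : NeZero (2 * m) := ⟨by have := NeZero.ne m; omega⟩
  refine c2_quaternion_presentation (m := m) fun ρ τ c₀ hρρ hρτ hτρ hττ hρ hτ hne hsurj _ => ?_
  have key := tpp_volume_le_law_dihedralLike hρρ hρτ hτρ hττ hρ hτ hne hsurj
    (by rw [Fintype.card_prod, ZMod.card, ZMod.card]; have := NeZero.ne m; omega) h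
  rw [Fintype.card_prod, ZMod.card, ZMod.card] at key
  have e : 2 * (2 * (2 * m)) = 8 * m := by ring
  rwa [e] at key

/-- **`β(C₂ × Q_{4m}) = 16⌊2m/3⌋` for `m ≥ 5`, `m ≢ 1 (mod 3)`** (both halves kernel). [folklore] -/
theorem c2_quaternion_law (hm : 5 ≤ m) (hmod : m % 3 ≠ 1) :
    (∀ S T U : Finset (Multiplicative (ZMod 2) × QuaternionGroup m), TripleProductProperty S T U →
        S.card * T.card * U.card ≤ 16 * (2 * m / 3)) ∧
    ∃ S T U : Finset (Multiplicative (ZMod 2) × QuaternionGroup m), TripleProductProperty S T U ∧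
      S.card * T.card * U.card = 16 * (2 * m / 3) := by
  haveI : NeZero (2 * m) := ⟨by omega⟩
  refine ⟨fun S T U h => ?_, c2_quaternion_volume_ge (by omega)⟩
  by_cases h0 : m % 3 = 0
  · have := c2_quaternion_tpp_volume_le_law h
    omega
  · -- `m ≡ 2 (mod 3)`: the dicyclic law
    refine c2_quaternion_presentation (m := m) fun ρ τ c₀ hρρ hρτ hτρ hττ hρ hτ hne hsurj hc => ?_
    have hc0 : c₀ ≠ 0 := by
      rw [hc]; intro h0'
      have h1 : (m : ZMod (2 * m)) = 0 := congrArg Prod.snd h0'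
      rw [ZMod.natCast_eq_zero_iff] at h1
      have := Nat.le_of_dvd (by omega) h1
      omega
    have key := tpp_volume_le_law_dicyclicLike hρρ hρτ hτρ hττ hρ hτ hne hsurj (two_c0_eq_zero hρτ hτρ hττ hτ) hc0
      (by rw [Fintype.card_prod, ZMod.card, ZMod.card]; omega)
      (by rw [Fintype.card_prod, ZMod.card, ZMod.card]; omega) h
    rw [Fintype.card_prod, ZMod.card, ZMod.card] at key
    omega

/-- **`m ≡ 1 (mod 6)`, `m ≥ 7`: `β(C₂ × Q_{4m}) = (32m − 8)/3`**, the mod-one law, attained (transport of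
`z2zn_mod_one_law_attained_zero_half`, `2m ≡ 2 (mod 4)`). [folklore] -/
theorem c2_quaternion_law_mod_six_one (hmod : m % 6 = 1) (hm : 7 ≤ m) :
    (∀ S T U : Finset (Multiplicative (ZMod 2) × QuaternionGroup m), TripleProductProperty S T U →
        3 * (S.card * T.card * U.card) + 8 ≤ 32 * m) ∧
    ∃ S T U : Finset (Multiplicative (ZMod 2) × QuaternionGroup m), TripleProductProperty S T U ∧
      3 * (S.card * T.card * U.card) + 8 = 32 * m := by
  haveI : NeZero (2 * m) := ⟨by omega⟩
  haveI : Fact (2 ∣ 2 * m) := ⟨dvd_mul_right 2 m⟩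
  refine ⟨fun S T U h => ?_, ?_⟩
  · have := c2_quaternion_tpp_volume_le_law h
    omega
  · obtain ⟨S, T, U, h, hV⟩ := z2zn_mod_one_law_attained_zero_half (n := 2 * m) (by omega) (by omega) (by omega)
    have hdiv : ((2 * m / 2 : ℕ) : ZMod (2 * m)) = (m : ZMod (2 * m)) := by
      rw [Nat.mul_div_cancel_left m (by norm_num)]
    refine c2_quaternion_presentation (m := m) fun ρ τ c₀ hρρ hρτ hτρ hττ hρ hτ hne hsurj hc => ?_
    have hττ' : ∀ a b, τ a * τ b = ρ ((((0 : ZMod 2), ((2 * m / 2 : ℕ) : ZMod (2 * m))) : ZMod 2 × ZMod (2 * m)) + b - a) :=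
      fun a b => by rw [hττ, hc, hdiv]
    let e := DihedralLikeGroup.equivOfPresentation hρρ hρτ hτρ hττ' hρ hτ hne hsurj
    obtain ⟨S', T', U', h', hV'⟩ := exists_tpp_volume_of_mulEquiv e ⟨S, T, U, h, rfl⟩
    refine ⟨S', T', U', h', ?_⟩
    rw [hV']; rw [Fintype.card_prod, ZMod.card, ZMod.card] at hV; omega

/-- **`m ≡ 4 (mod 6)`: `(32m − 32)/3 = 16⌊2m/3⌋ ≤ β(C₂ × Q_{4m}) ≤ (32m − 14)/3`** — the mod-one law is not attained (H′,
`no_mod_one_law_c2_quaternion`) and `law − 1` never occurs (`tpp_volume_mod_one_gap`). [folklore] -/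
theorem c2_quaternion_window_mod_six_four (hmod : m % 6 = 4) :
    (∀ S T U : Finset (Multiplicative (ZMod 2) × QuaternionGroup m), TripleProductProperty S T U →
        3 * (S.card * T.card * U.card) + 14 ≤ 32 * m) ∧
    ∃ S T U : Finset (Multiplicative (ZMod 2) × QuaternionGroup m), TripleProductProperty S T U ∧
      S.card * T.card * U.card = 16 * (2 * m / 3) := by
  haveI : NeZero (2 * m) := ⟨by omega⟩
  refine ⟨fun S T U h => ?_, c2_quaternion_volume_ge (by omega)⟩
  have hne := no_mod_one_law_c2_quaternion (m := m) ⟨m / 2, by omega⟩ (by omega) h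
  refine c2_quaternion_presentation (m := m) fun ρ τ c₀ hρρ hρτ hτρ hττ hρ hτ hne' hsurj _ => ?_
  have key := tpp_volume_mod_one_gap hρρ hρτ hτρ hττ hρ hτ hne' hsurj
    (by rw [Fintype.card_prod, ZMod.card, ZMod.card]; omega)
    (by rw [Fintype.card_prod, ZMod.card, ZMod.card]; omega) h
  rw [Fintype.card_prod, ZMod.card, ZMod.card] at key
  omega

end C2Q

end Summit.MatrixMultiplication.OmegaCensus
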